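import Literature.NumberTheory.EllipticCurves.ShintaniSplitOrbits
import Literature.NumberTheory.EllipticCurves.TunnellHalfIntegralForms
import HarnessLib

/-!
# The `q`-expansion of the twisted Shintani lift

[[cite: Shintani1975, §2, (2.14)–(2.15) and Props. 2.3–2.4]] — collecting the orbit evaluations
(`ShintaniLiftUnfolded`, `ShintaniAnisotropicOrbits`, `ShintaniSplitOrbits`): every indefinite
orbit `ω` with `c_D(k_ω) ≠ 0` has `Δ(k_ω) = 256 · D · n_ω` (`n_ω = n(v_ω)/D ∈ ℕ`, `v = (k₀, k₁/128, k₂)`),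
and `√(Im z) · J_z(ω) = coef(ω) · e(n_ω z)` with a `z`-INDEPENDENT coefficient
`coef(ω) = c_D(k_ω) · 8√D · sgn(λ) P(ω)` (`P(ω)` the cycle integral resp. cusp-to-cusp period of `φ`,
chosen uniformly in `D` and `z`: `exists_orbit_data`).  Summing fibrewise,
`Φ_D(z) = ∑_n c_D(n) qⁿ` with `c_D(n) = ∑_{n_ω = n} coef(ω)`.  We PROVE:

* `lam_sq_eq_disc`, `intDisc_eq_mul_of_cD_ne_zero`, `sqrt_im_mul_const` (the `Im z` cancels);
* `orbitIntegral_aniso_unif`, `orbitIntegral_split_unif`, `exists_orbit_data`;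
* `orbExp`, `orbCoef`, **`sqrt_im_mul_orbitTerm`**, `hasSum_orbitTerm`, `liftCoeff`,
  **`hasSum_liftCoeff`** and **`qCoeffs_shintaniLift`** — `qCoeffs (Φ_D) = c_D`.

No named facts; the definitions are `vOf`, `orbExp`, `orbCoef`, `liftCoeff`.
-/

noncomputable section

open scoped MatrixGroups ModularForm Modular Topology ENNReal Pointwise Manifold
open UpperHalfPlane hiding I
open Complex Filter MeasureTheory Set CongruenceSubgroup ModularGroup Real MulAction
open Literature.NumberTheory.EllipticCurves.ModularForms

namespace Literature.NumberTheory.EllipticCurves.Shintani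

/-! ### `λ² = Δ` and the exponent `n = Δ/(256 D)` -/

/-- From `x ∘ M = λXY`: `λ² = disc x`. [folklore] -/
theorem lam_sq_eq_disc {x : V} {M : SL(2, ℝ)} {lam : ℝ} (hM : actSL M x = xyForm lam) : lam ^ 2 = disc x := by
  have h := disc_actV (M 0 0) (M 0 1) (M 1 0) (M 1 1) x
  rw [det_entries_real M, one_pow, one_mul] at h
  rw [← h, show actV (M 0 0 : ℝ) (M 0 1) (M 1 0) (M 1 1) x = actSL M x from rfl, hM]
  simp [disc, xyForm]

/-- The coordinates `v = (k₀, k₁/128, k₂)` of `k ∈ L = {128 ∣ k₁}`. [folklore] -/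
def vOf (k : Fin 3 → ℤ) : Fin 3 → ℤ := ![k 0, k 1 / 128, k 2]

/-- On `L`: `Δ(k) = 256 · n(v)`, `n(v) = 64 v₁² - v₀ v₂`. [folklore] -/
theorem intDisc_eq_of_dvd {k : Fin 3 → ℤ} (h : (128 : ℤ) ∣ k 1) : intDisc k = 256 * nQ (vOf k) := by
  obtain ⟨t, ht⟩ := h
  have hdiv : 128 * t / 128 = t := by omega
  rw [intDisc, nQ, vOf, ht]
  simp [hdiv]
  ring

/-- `c_D(k) ≠ 0` forces `128 ∣ k₁` and `D ∣ n(v)` (`D` square-free). [folklore] -/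
theorem dvd_of_cD_ne_zero {D : ℕ} (hD : Squarefree D) {k : Fin 3 → ℤ} (h : cD D k ≠ 0) :
    (128 : ℤ) ∣ k 1 ∧ (D : ℤ) ∣ nQ (vOf k) := by
  by_cases h1 : (128 : ℤ) ∣ k 1
  · refine ⟨h1, ?_⟩
    by_contra hnd
    apply h
    rw [cD, if_pos h1, show (![k 0, k 1 / 128, k 2] : Fin 3 → ℤ) = vOf k from rfl, genusWt_of_not_dvd hD hnd]
    simp
  · exact absurd (cD_of_not_dvd h1) h

/-- **The exponent**: for `c_D(k) ≠ 0`, `Δ(k) = 256 · D · n` with `n = n(v)/D ∈ ℤ`. [folklore] -/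
theorem intDisc_eq_mul_of_cD_ne_zero {D : ℕ} (hD : Squarefree D) {k : Fin 3 → ℤ} (h : cD D k ≠ 0) :
    intDisc k = 256 * D * (nQ (vOf k) / D) := by
  obtain ⟨h1, hdvd⟩ := dvd_of_cD_ne_zero hD h
  rw [intDisc_eq_of_dvd h1, mul_assoc, Int.mul_ediv_cancel' hdvd]

/-! ### The constant: `√(Im z) · λ e(λ²Z) · √(π/(4π Im Z λ²)) = 8√D · sgn(λ) · e(Δ z/(256D))` -/

variable (D : ℕ) [NeZero D]

/-- `(Z : ℂ) = z/(256D)` and `Im Z = Im z/(256D)`. [folklore] -/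
theorem coe_zScaled (z : ℍ) : ((zScaled D z : ℍ) : ℂ) = (z : ℂ) / (256 * D) := by
  rw [zScaled, coe_mulPos]; push_cast; ring

/-- `Im Z = Im z/(256D)`. [folklore] -/
theorem im_zScaled (z : ℍ) : (zScaled D z : ℂ).im = (z : ℂ).im / (256 * D) := by
  rw [coe_zScaled, show (256 * (D : ℂ)) = ((256 * D : ℝ) : ℂ) by push_cast; ring, Complex.div_ofReal_im]

/-- **The `z`-dependence of an orbit term is a pure exponential**:
`√(Im z) · (λ e(λ²Z)) · √(π/(4π Im Z λ²)) = 8√D sgn(λ) · e(λ² z/(256 D))`. [folklore] -/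
theorem sqrt_im_mul_const (z : ℍ) {lam : ℝ} (hlam : lam ≠ 0) :
    (Real.sqrt z.im : ℂ) * (((lam : ℂ) * cexp (2 * π * I * (lam ^ 2 : ℝ) * (zScaled D z : ℂ))) *
      (Real.sqrt (π / (4 * π * (zScaled D z : ℂ).im * lam ^ 2)) : ℂ)) =
      (8 * Real.sqrt D * (lam / abs lam) : ℝ) * cexp (2 * π * I * ((lam ^ 2 / (256 * D) : ℝ)) * (z : ℂ)) := by
  have hD0 : (0 : ℝ) < D := by exact_mod_cast Nat.pos_of_ne_zero (NeZero.ne D)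
  have hy : 0 < z.im := z.im_pos
  have himZ : (zScaled D z : ℂ).im = z.im / (256 * D) := by rw [im_zScaled]; rfl
  -- the exponentials agree
  have hexp : cexp (2 * π * I * (lam ^ 2 : ℝ) * (zScaled D z : ℂ)) =
      cexp (2 * π * I * ((lam ^ 2 / (256 * D) : ℝ)) * (z : ℂ)) := by
    congr 1; rw [coe_zScaled]; push_cast; field_simp
  -- the real constants agree: `√y · √(π/(4π (y/(256D)) λ²)) = 8 √D / |λ|`
  have hsq : Real.sqrt z.im * Real.sqrt (π / (4 * π * (zScaled D z : ℂ).im * lam ^ 2)) = 8 * Real.sqrt D / abs lam := by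
    rw [himZ, ← Real.sqrt_mul hy.le]
    have : z.im * (π / (4 * π * (z.im / (256 * D)) * lam ^ 2)) = (8 * Real.sqrt D / abs lam) ^ 2 := by
      rw [div_pow, mul_pow, Real.sq_sqrt hD0.le, sq_abs]
      field_simp
      ring
    rw [this, Real.sqrt_sq (by positivity)]
  rw [hexp]
  have key : (Real.sqrt z.im : ℂ) * (((lam : ℂ) * cexp (2 * π * I * ((lam ^ 2 / (256 * D) : ℝ)) * (z : ℂ))) *
      (Real.sqrt (π / (4 * π * (zScaled D z : ℂ).im * lam ^ 2)) : ℂ)) =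
      ((Real.sqrt z.im * Real.sqrt (π / (4 * π * (zScaled D z : ℂ).im * lam ^ 2)) * lam : ℝ) : ℂ) *
        cexp (2 * π * I * ((lam ^ 2 / (256 * D) : ℝ)) * (z : ℂ)) := by
    push_cast; ring
  rw [key, hsq]
  congr 1
  simp only [Complex.ofReal_mul, Complex.ofReal_div]
  have hl : (Complex.ofReal (abs lam)) ≠ 0 := Complex.ofReal_ne_zero.mpr (abs_ne_zero.mpr hlam)
  field_simp

/-! ### The orbit formulas with data chosen uniformly in `z` -/

/-- `orbitIntegral_aniso` with `M, λ, κ₀` chosen independently of `z`. [cite: Shintani1975, §2, Prop. 2.3] -/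
theorem orbitIntegral_aniso_unif (f : CuspForm (Gamma0 64) 2)
    (ω : orbitRel.Quotient (Gamma0Plus 64) (Fin 3 → ℤ)) (hpos : 0 < intDisc ω.out)
    (hnsq : ¬ IsSquare (intDisc ω.out)) :
    ∃ (M : SL(2, ℝ)) (lam κ₀ : ℝ), lam ≠ 0 ∧ 1 < κ₀ ∧ actSL M (latSharp ω.out) = xyForm lam ∧
      ∀ (D : ℕ) [NeZero D], Odd D → ∀ z : ℍ, orbitIntegral D f z ω = anisoConst D z ω.out lam *
        rayIntegral (slashSL f M) (π / 2) 1 κ₀ *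
          (Real.sqrt (π / (4 * π * (zScaled D z : ℂ).im * lam ^ 2)) : ℝ) := by
  set k₀ := ω.out with hk₀
  obtain ⟨M, lam, κ₀, m, hlam, hκ, hM, hm, hact⟩ := indef_stabilizer k₀ hpos hnsq
  refine ⟨M, lam, κ₀, hlam, hκ, hM, fun D _ hD z ↦ ?_⟩
  have hκ0 : 0 < κ₀ := by linarith
  -- the two fundamental domains of `Γ_{k₀}`
  have hFD := isFundamentalDomain_orbitDomain k₀
  have hFD' : IsFundamentalDomain (stabK k₀) (M • hannulus κ₀) (volume : Measure ℍ) :=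
    isFundamentalDomain_conj_hannulus M hκ m hm (fun γ w ↦ hact γ w)
  have hinv : ∀ (γ : stabK k₀) (w : ℍ), liftTerm D f z k₀ (γ • w) = liftTerm D f z k₀ w :=
    liftTerm_stab_invariant D hD f z k₀
  unfold orbitIntegral
  rw [← hk₀, hFD.setIntegral_eq hFD' hinv, setIntegral_sl_smul_set_real,
    setIntegral_congr_set (hannulus_ae_eq_Ioo κ₀)]
  simp_rw [liftTerm_sl_smul f z hM]
  -- the sibling's evaluation
  obtain ⟨C₀, -, hC₀⟩ := exists_norm_mul_im_le f
  obtain ⟨γ₁, hγ₁⟩ := hm.2 1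
  have hgen : ∀ w : ℍ, (((M⁻¹ • (((γ₁ : Gamma0Plus 64) : SL(2, ℤ)) • w) : ℍ)) : ℂ) =
      ((κ₀ : ℝ) : ℂ) * (((M⁻¹ • w : ℍ)) : ℂ) := by
    intro w; rw [hact γ₁ w, hγ₁, zpow_one]
  have hc : 0 < 4 * π * (zScaled D z : ℂ).im * lam ^ 2 := by
    have h1 : 0 < (zScaled D z : ℂ).im := by rw [UpperHalfPlane.coe_im]; exact (zScaled D z).im_pos
    have h2 : 0 < lam ^ 2 := by positivity
    positivity
  have hCψ : ∀ w : ℂ, 0 < w.im → ‖slashSL f M w * anisoConst D z k₀ lam‖ * w.im ≤ C₀ * ‖anisoConst D z k₀ lam‖ := by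
    intro w hw
    calc ‖slashSL f M w * anisoConst D z k₀ lam‖ * w.im
        = (‖slashSL f M w‖ * w.im) * ‖anisoConst D z k₀ lam‖ := by rw [norm_mul]; ring
      _ ≤ C₀ * ‖anisoConst D z k₀ lam‖ :=
        mul_le_mul_of_nonneg_right (norm_slashSL_mul_im_le f M hC₀ hw) (norm_nonneg _)
  have key := setIntegral_upperHalfPlane_annulus_eq (ψ := fun τ ↦ slashSL f M τ * anisoConst D z k₀ lam)
    (c := 4 * π * (zScaled D z : ℂ).im * lam ^ 2) (C := C₀ * ‖anisoConst D z k₀ lam‖) (r₁ := 1) (r₂ := κ₀)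
    ((differentiableOn_slashSL f M).mul_const _) hCψ hc one_pos hκ.le
    (fun w hw ↦ slashSL_mul_inv hD f z hκ hM hgen hw)
  rw [rayIntegral_mul_const] at key
  rw [← key]


/-- `orbitIntegral_split` with `M, λ` chosen independently of `z`. [cite: Shintani1975, §2, Prop. 2.4] -/
theorem orbitIntegral_split_unif (f : CuspForm (Gamma0 64) 2)
    (ω : orbitRel.Quotient (Gamma0Plus 64) (Fin 3 → ℤ)) {m₀ : ℤ} (hm₀ : 0 < m₀)
    (hΔ : intDisc ω.out = m₀ ^ 2) :
    ∃ (M : SL(2, ℝ)) (lam : ℝ), lam ≠ 0 ∧ actSL M (latSharp ω.out) = xyForm lam ∧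
      ∀ (D : ℕ) [NeZero D], Odd D → ∀ z : ℍ, orbitIntegral D f z ω = anisoConst D z ω.out lam *
        (∫ r in Ioi (0 : ℝ), slashSL f M (polarPt r (π / 2)) * unitAt (π / 2)) *
          (Real.sqrt (π / (4 * π * (zScaled D z : ℂ).im * lam ^ 2)) : ℝ) := by
  set k₀ := ω.out with hk₀
  have hposR : 0 < disc (latSharp k₀) := by
    rw [disc_latSharp_eq_intDisc, hΔ]; push_cast; exact pow_pos (by exact_mod_cast hm₀) 2
  obtain ⟨a, b, c, d, lam, hdet, hlam, hconj⟩ := exists_conj_to_xyForm hposR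
  set M : SL(2, ℝ) := slOf a b c d hdet with hMdef
  have hM : actSL M (latSharp k₀) = xyForm lam := by rw [hMdef, actSL_slOf]; exact hconj
  refine ⟨M, lam, hlam, hM, fun D _ hD z ↦ ?_⟩
  obtain ⟨⟨A, Nu, hN, hMfac⟩, ⟨A', Nu', hN', hPfac⟩⟩ := exists_factorizations_of_sq hm₀ hΔ hM
  -- trivial stabiliser: `orbitDomain` and `univ` are both fundamental domains
  have hbot := stabK_eq_bot_of_sq hm₀ hΔ (k₀ := k₀)
  haveI : Subsingleton (stabK k₀) := by rw [hbot]; infer_instance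
  have hFD := isFundamentalDomain_orbitDomain k₀
  have hFD' : IsFundamentalDomain (stabK k₀) (Set.univ : Set ℍ) (volume : Measure ℍ) :=
    isFundamentalDomain_univ_of_subsingleton
  have hinv : ∀ (γ : stabK k₀) (w : ℍ), liftTerm D f z k₀ (γ • w) = liftTerm D f z k₀ w :=
    liftTerm_stab_invariant D hD f z k₀
  -- integrability on `ℍ`, transported and moved to the plane
  have hintH : IntegrableOn (liftTerm D f z k₀) Set.univ (volume : Measure ℍ) :=
    (hFD.integrableOn_iff hFD' hinv).mp (tsum_quotient_integral_liftTerm_eq hD f z k₀).1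
  have hintM : IntegrableOn (fun u ↦ liftTerm D f z k₀ (M • u)) Set.univ (volume : Measure ℍ) := by
    rw [← integrableOn_sl_smul_set_real_iff M, Set.smul_set_univ]; exact hintH
  set ψ : ℂ → ℂ := fun τ ↦ slashSL f M τ * anisoConst D z k₀ lam with hψdef
  set cc : ℝ := 4 * π * (zScaled D z : ℂ).im * lam ^ 2 with hcc
  have hcpos : 0 < cc := by
    have h1 : 0 < (zScaled D z : ℂ).im := by rw [UpperHalfPlane.coe_im]; exact (zScaled D z).im_pos
    positivity
  have hplane_eq : ∀ w : ℂ, 0 < w.im →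
      ((1 / w.im ^ 2 : ℝ) : ℂ) * liftTerm D f z k₀ (M • UpperHalfPlane.ofComplex w) = planeIntegrand ψ cc w := by
    intro w hw
    rw [liftTerm_sl_smul f z hM, planeIntegrand, UpperHalfPlane.ofComplex_apply_of_im_pos hw]
  have hplane : IntegrableOn (planeIntegrand ψ cc) {w : ℂ | 0 < w.im} := by
    have h := (FdCoord.integrableOn_image_iff (fun u ↦ liftTerm D f z k₀ (M • u)) MeasurableSet.univ).mpr hintM
    rw [image_univ, UpperHalfPlane.range_coe] at h
    exact h.congr_fun (fun w hw ↦ hplane_eq w hw) (measurableSet_lt measurable_const Complex.measurable_im)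
  -- the sibling's evaluation
  obtain ⟨C₀, -, hC₀⟩ := exists_norm_mul_im_le f
  have hCψ : ∀ w : ℂ, 0 < w.im → ‖ψ w‖ * w.im ≤ C₀ * ‖anisoConst D z k₀ lam‖ := by
    intro w hw
    calc ‖slashSL f M w * anisoConst D z k₀ lam‖ * w.im
        = (‖slashSL f M w‖ * w.im) * ‖anisoConst D z k₀ lam‖ := by rw [norm_mul]; ring
      _ ≤ C₀ * ‖anisoConst D z k₀ lam‖ :=
        mul_le_mul_of_nonneg_right (norm_slashSL_mul_im_le f M hC₀ hw) (norm_nonneg _)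
  have hψhol : DifferentiableOn ℂ ψ {w : ℂ | 0 < w.im} := (differentiableOn_slashSL f M).mul_const _
  have key := integral_sectorSet_Ioi_eq_mul_sqrt (ψ := ψ) (c := cc) hψhol hCψ
    (fun y hy ↦ tendsto_slashSL_mul_nhdsGT_zero f hN' hPfac _ hy)
    (fun y hy ↦ tendsto_slashSL_mul_atTop f hN hMfac _ hy)
    (fun θ hθ ↦ integrableOn_ray f hN hMfac hN' hPfac _ hθ)
    (integrableOn_polarIntegrand_of_plane hψhol.continuousOn hplane)
  -- assemble
  unfold orbitIntegral
  rw [← hk₀, hFD.setIntegral_eq hFD' hinv, ← Set.smul_set_univ (a := M), setIntegral_sl_smul_set_real,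
    FdCoord.setIntegral_eq_setIntegral_image _ MeasurableSet.univ, image_univ, UpperHalfPlane.range_coe]
  rw [show (UpperHalfPlane.upperHalfPlaneSet : Set ℂ) = {w : ℂ | 0 < w.im} from rfl,
    setIntegral_congr_fun (measurableSet_lt measurable_const Complex.measurable_im) (fun w hw ↦ hplane_eq w hw),
    setOf_im_pos_eq_sectorSet, key]
  -- pull the constant out of the ray integral
  have hray : ∫ r in Ioi (0 : ℝ), ψ (polarPt r (π / 2)) * unitAt (π / 2) =
      anisoConst D z k₀ lam * ∫ r in Ioi (0 : ℝ), slashSL f M (polarPt r (π / 2)) * unitAt (π / 2) := by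
    rw [← integral_const_mul]
    refine integral_congr_ae (Eventually.of_forall fun r ↦ ?_)
    simp only [hψdef]; ring
  rw [hray]


/-! ### The orbit term as `coef(ω) · e(n_ω z)` -/

/-- **Uniform orbit data**: for `Δ(k_ω) > 0` there are `λ ≠ 0` with `λ² = Δ(k_ω)` and a
`z`-INDEPENDENT number `P(ω)` (a cycle integral or a cusp-to-cusp period of `φ`) with
`J_z(ω) = c_D(k_ω) λ e(λ²Z) · P(ω) · √(π/(4π Im Z λ²))` for all `z`. [cite: Shintani1975, §2, Props. 2.3–2.4] -/
theorem exists_orbit_data (f : CuspForm (Gamma0 64) 2)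
    (ω : orbitRel.Quotient (Gamma0Plus 64) (Fin 3 → ℤ)) (hpos : 0 < intDisc ω.out) :
    ∃ (lam : ℝ) (P : ℂ), lam ≠ 0 ∧ lam ^ 2 = intDisc ω.out ∧
      ∀ (D : ℕ) [NeZero D], Odd D → ∀ z : ℍ, orbitIntegral D f z ω = anisoConst D z ω.out lam * P *
        (Real.sqrt (π / (4 * π * (zScaled D z : ℂ).im * lam ^ 2)) : ℝ) := by
  have hl2 : ∀ {M : SL(2, ℝ)} {lam : ℝ}, actSL M (latSharp ω.out) = xyForm lam → lam ^ 2 = intDisc ω.out := by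
    intro M lam hM
    have h := lam_sq_eq_disc hM
    rw [disc_latSharp_eq_intDisc] at h
    exact_mod_cast h
  by_cases hsq : IsSquare (intDisc ω.out)
  · obtain ⟨r, hr⟩ := hsq
    have hm₀ : 0 < |r| := by
      rcases eq_or_ne r 0 with h0 | h0
      · rw [hr, h0, mul_zero] at hpos; exact absurd hpos (lt_irrefl 0)
      · exact abs_pos.mpr h0
    have hΔ : intDisc ω.out = |r| ^ 2 := by rw [hr, sq_abs]; ring
    obtain ⟨M, lam, hlam, hM, hJ⟩ := orbitIntegral_split_unif f ω hm₀ hΔ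
    exact ⟨lam, _, hlam, hl2 hM, hJ⟩
  · obtain ⟨M, lam, κ₀, hlam, -, hM, hJ⟩ := orbitIntegral_aniso_unif f ω hpos hsq
    exact ⟨lam, _, hlam, hl2 hM, hJ⟩

/-- The exponent `n_ω = n(v_ω)/D` (meaningful when `c_D(k_ω) ≠ 0`). [folklore] -/
def orbExp (ω : orbitRel.Quotient (Gamma0Plus 64) (Fin 3 → ℤ)) : ℕ := (nQ (vOf ω.out) / D).toNat

/-- The `z`-independent coefficient of the orbit `ω`:
`coef(ω) = c_D(k_ω) · 8√D sgn(λ) · P(ω)` (and `0` for non-indefinite `ω`). [folklore] -/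
def orbCoef (f : CuspForm (Gamma0 64) 2) (ω : orbitRel.Quotient (Gamma0Plus 64) (Fin 3 → ℤ)) : ℂ :=
  if h : 0 < intDisc ω.out then
    cD D ω.out * ((8 * Real.sqrt D * ((exists_orbit_data f ω h).choose / abs (exists_orbit_data f ω h).choose) : ℝ) : ℂ) *
      (exists_orbit_data f ω h).choose_spec.choose
  else 0

/-- **The orbit term is a monomial in `q = e(z)`**:
`√(Im z) · J_z(ω) = coef(ω) · e(n_ω z)` (both sides `0` unless `ω` is indefinite with
`c_D(k_ω) ≠ 0`). [cite: Shintani1975, §2, (2.14)–(2.15)] -/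
theorem sqrt_im_mul_orbitTerm (hD : Odd D) (hDsq : Squarefree D) (f : CuspForm (Gamma0 64) 2) (z : ℍ)
    (ω : orbitRel.Quotient (Gamma0Plus 64) (Fin 3 → ℤ)) :
    (Real.sqrt z.im : ℂ) * (if 0 < disc (latSharp ω.out) then orbitIntegral D f z ω else 0) =
      orbCoef D f ω * cexp (2 * π * I * (orbExp D ω : ℕ) * (z : ℂ)) := by
  have hiff : 0 < disc (latSharp ω.out) ↔ 0 < intDisc ω.out := by
    rw [disc_latSharp_eq_intDisc]; exact_mod_cast Iff.rfl
  by_cases hpos : 0 < intDisc ω.out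
  · rw [if_pos (hiff.mpr hpos), orbCoef, dif_pos hpos]
    set lam := (exists_orbit_data f ω hpos).choose with hlamdef
    set P := (exists_orbit_data f ω hpos).choose_spec.choose with hPdef
    obtain ⟨hlam, hl2, hJ⟩ := (exists_orbit_data f ω hpos).choose_spec.choose_spec
    rw [hJ D hD z, anisoConst]
    by_cases hc : cD D ω.out = 0
    · rw [hc]; simp
    · -- the exponent
      have hn : ((lam ^ 2 / (256 * D) : ℝ)) = ((orbExp D ω : ℕ) : ℝ) := by
        have hΔ := intDisc_eq_mul_of_cD_ne_zero hDsq hc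
        have hq : 0 < nQ (vOf ω.out) / D := by
          have hD0 : (0 : ℤ) < 256 * D := by
            have : 0 < D := Nat.pos_of_ne_zero hDsq.ne_zero
            positivity
          rw [hΔ] at hpos
          exact pos_of_mul_pos_right hpos hD0.le
        rw [orbExp, hl2, hΔ]
        have hD0 : (D : ℝ) ≠ 0 := by exact_mod_cast hDsq.ne_zero
        push_cast
        rw [show ((nQ (vOf ω.out) / ↑D).toNat : ℝ) = ((nQ (vOf ω.out) / D : ℤ) : ℝ) by
          rw [← Int.toNat_of_nonneg hq.le]; push_cast; rw [Int.toNat_of_nonneg hq.le]]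
        field_simp
      have key := sqrt_im_mul_const D z hlam
      rw [hn] at key
      calc (Real.sqrt z.im : ℂ) * (cD D ω.out * ((lam : ℂ) * cexp (2 * π * I * (lam ^ 2 : ℝ) * (zScaled D z : ℂ))) * P *
            (Real.sqrt (π / (4 * π * (zScaled D z : ℂ).im * lam ^ 2)) : ℂ))
          = cD D ω.out * P * ((Real.sqrt z.im : ℂ) * (((lam : ℂ) * cexp (2 * π * I * (lam ^ 2 : ℝ) * (zScaled D z : ℂ))) *
            (Real.sqrt (π / (4 * π * (zScaled D z : ℂ).im * lam ^ 2)) : ℂ))) := by ring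
        _ = cD D ω.out * P * ((8 * Real.sqrt D * (lam / abs lam) : ℝ) * cexp (2 * π * I * ((orbExp D ω : ℕ) : ℝ) * (z : ℂ))) := by
            rw [key]
        _ = _ := by push_cast; ring
  · rw [if_neg (fun h ↦ hpos (hiff.mp h)), orbCoef, dif_neg hpos]
    simp


/-! ### The `q`-series of the lift -/

/-- The orbit terms `T_z(ω) = √(Im z) · 1_{Δ>0} J_z(ω)` sum to `Φ_D(z)` (a `HasSum`, obtained
fibrewise from the absolutely convergent lattice sum). [cite: Shintani1975, §2, (2.14)] -/
theorem hasSum_orbitTerm (hD : Odd D) (f : CuspForm (Gamma0 64) 2) (z : ℍ) :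
    HasSum (fun ω : orbitRel.Quotient (Gamma0Plus 64) (Fin 3 → ℤ) ↦
      (Real.sqrt z.im : ℂ) * (if 0 < disc (latSharp ω.out) then orbitIntegral D f z ω else 0))
      (shintaniLift D f z) := by
  have hsum : Summable fun k : Fin 3 → ℤ ↦ ∫ w in liftDomain, liftTerm D f z k w :=
    (summable_norm_integral_liftTerm D f z).of_norm
  have hfib := (hsum.hasSum.tsum_fiberwise
    (Quotient.mk'' : (Fin 3 → ℤ) → orbitRel.Quotient (Gamma0Plus 64) (Fin 3 → ℤ))).mul_left (Real.sqrt z.im : ℂ)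
  rw [← shintaniLift_eq_tsum_integral D f z] at hfib
  refine hfib.congr_fun fun ω ↦ ?_
  congr 1
  -- the fibre sum over `ω` is the orbit integral (as in `shintaniLift_eq_tsum_orbitIntegral`)
  have h1 : ∑' b : ((Quotient.mk'' : (Fin 3 → ℤ) → orbitRel.Quotient (Gamma0Plus 64) (Fin 3 → ℤ)) ⁻¹' {ω}),
      ∫ w in liftDomain, liftTerm D f z (b : Fin 3 → ℤ) w =
      ∑' x : orbitRel.Quotient.orbit ω, ∫ w in liftDomain, liftTerm D f z (x : Fin 3 → ℤ) w :=
    ((Equiv.setCongr (preimage_orbitRel_mk_eq_orbit ω)).symm.tsum_eq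
      (fun x : ((Quotient.mk'' : (Fin 3 → ℤ) → orbitRel.Quotient (Gamma0Plus 64) (Fin 3 → ℤ)) ⁻¹' {ω}) ↦
        ∫ w in liftDomain, liftTerm D f z (x : Fin 3 → ℤ) w)).symm
  rw [h1]
  have hω := Quotient.out_eq' ω
  have h2 : ∑' x : orbitRel.Quotient.orbit ω, ∫ w in liftDomain, liftTerm D f z (x : Fin 3 → ℤ) w =
      ∑' q : Gamma0Plus 64 ⧸ stabK ω.out, ∫ w in liftDomain, liftTerm D f z (q.out • ω.out) w := by
    conv_lhs => rw [← hω]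
    exact (tsum_orbitRel_mk_eq (G := Gamma0Plus 64) (fun k : Fin 3 → ℤ ↦ ∫ w in liftDomain, liftTerm D f z k w) ω.out).trans
      (tsum_orbit_eq_tsum_quotient_stabilizer (G := Gamma0Plus 64) (fun k : Fin 3 → ℤ ↦ ∫ w in liftDomain, liftTerm D f z k w) ω.out)
  rw [h2, (tsum_quotient_integral_liftTerm_eq hD f z ω.out).2]
  split_ifs with h
  · rfl
  · exact (orbitIntegral_eq_zero_of_disc_nonpos D hD f z ω (not_lt.mp h)).symm

/-- **The coefficients of the lift**: `c_D(n) = ∑_{ω : n_ω = n} coef(ω)`. [cite: Shintani1975, §2, (2.15)] -/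
def liftCoeff (f : CuspForm (Gamma0 64) 2) (n : ℕ) : ℂ :=
  ∑' ω : ((orbExp D) ⁻¹' {n} : Set (orbitRel.Quotient (Gamma0Plus 64) (Fin 3 → ℤ))), orbCoef D f ω

/-- **The lift is a `q`-series**: `Φ_D(z) = ∑_n c_D(n) e(nz)`. [cite: Shintani1975, §2, (2.15)] -/
theorem hasSum_liftCoeff (hD : Odd D) (hDsq : Squarefree D) (f : CuspForm (Gamma0 64) 2) (z : ℍ) :
    HasSum (fun n : ℕ ↦ liftCoeff D f n * Function.Periodic.qParam 1 z ^ n) (shintaniLift D f z) := by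
  have h := (hasSum_orbitTerm D hD f z).tsum_fiberwise (orbExp D)
  refine h.congr_fun fun n ↦ ?_
  rw [liftCoeff, ← tsum_mul_right]
  refine tsum_congr fun ω ↦ ?_
  rw [sqrt_im_mul_orbitTerm D hD hDsq f z, show orbExp D (ω : orbitRel.Quotient (Gamma0Plus 64) (Fin 3 → ℤ)) = n from ω.2]
  congr 1
  rw [Function.Periodic.qParam, ← Complex.exp_nat_mul]
  congr 1
  push_cast
  ring

/-- **The `q`-expansion coefficients of the Shintani lift.** [cite: Shintani1975, §2, (2.15)] -/
theorem qCoeffs_shintaniLift (hD : Odd D) (hDsq : Squarefree D) (f : CuspForm (Gamma0 64) 2) :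
    qCoeffs (shintaniLift D f) = liftCoeff D f :=
  qCoeffs_eq_of_hasSum (hasSum_liftCoeff D hD hDsq f)

end Literature.NumberTheory.EllipticCurves.Shintani
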